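import Literature.Probability.RandomPlanarGeometry.SAWPulledBridgeFreeEnergyZdEnvelope
import Literature.Probability.RandomPlanarGeometry.SAWPulledLargeForceExpansionZdFourthOrder
import HarnessLib

/-!
# The pulled-bridge free energy on `ℤ^{d+1}` from below: `E³ ≥ yE² + 2dyE + 2d(2d−1)y` for `E = e^{λ_B(y)}`, every `y > 0`;
# hence `2d − 4d²/(y+2d) ≤ e^{λ_B(y)} − y ≤ 2d` for every `y ≥ 1`, every dimension

Topic `Literature/Probability/RandomPlanarGeometry` (continues `SAWPulledBridgeFreeEnergyZdEnvelope.lean`: `e^{λ_B(y)} ≤ y + 2d` for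
`y ≥ 1`; uses `SAWPulledRenewalIdentity.sum_range_pulledBlockLaw_le_one` — the gap-free sub-Kesten inequality `Σ_{i<K} p_i(y) ≤ 1`
for every `y > 0` — and the block law split by cost `pulledBlockLaw_eq_sum_costCoeffZd` (`SAWPulledLargeForceExpansionZd`) with the
cost censuses `N_{0,1} = 1`, `N_{1,2} = 2d`, `N_{2,3} = 2d(2d−1)`, `N_{1,1} = N_{0,2} = N_{2,2} = N_{0,3} = N_{1,3} = 0`
(`SAWPulledLargeForceExpansionZdFirstOrder`) and `N_{3,3} = 0` (`costCoeffZd_eq_zero_of_le`, `SAWPulledLargeForceExpansionZdFourthOrder`)).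

The first three blocks of the pulled renewal structure on `ℤ^{d+1}` are explicit: `p_1(y) = u`, `p_2(y) = 2d·u²/y`,
`p_3(y) = 2d(2d−1)·u³/y²` with `u = y e^{-λ_B(y)}` (the one-step bridge, the `2d` bridges `+e₀,±e_j`, the `2d(2d−1)` bridges
`+e₀,±e_j,±e_{j'}` without reversal).  The sub-Kesten inequality `p_1 + p_2 + p_3 ≤ 1` (no mass gap needed, every `y > 0`) is a
CUBIC inequality for `E = e^{λ_B(y)} = y/u`:

* ★★ `exp_pulledBridgeFreeEnergy_cubic_le : y·E² + 2d·y·E + 2d(2d−1)·y ≤ E³` for every `y > 0` and every `d`;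
* `exp_pulledBridgeFreeEnergy_quadratic_le : y·E + 2d·y ≤ E²`, ★★ `half_add_sqrt_le_exp_pulledBridgeFreeEnergy :
  (y + √(y² + 8dy))/2 ≤ e^{λ_B(y)}` (every `y > 0`);
* with the upper envelope `E ≤ y + 2d` of the previous file (`y ≥ 1`): ★★ **`two_mul_sub_le_exp_pulledBridgeFreeEnergy_sub :
  2d − 4d²/(y + 2d) ≤ e^{λ_B(y)} − y`**, i.e. together `2d·y/(y+2d) ≤ e^{λ_B(y)} − y ≤ 2d`, and the EXPLICIT first-order remainder
  ★★ `abs_exp_pulledBridgeFreeEnergy_sub_first_order_le : |e^{λ_B(y)} − (y + 2d)| ≤ 4d²/(y + 2d)` for every `y ≥ 1`, every `d`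
  (the tree's `exp_pulledBridgeFreeEnergy_first_order_zd` has `∃ C y₁`);
* second order from below: `two_blocks_le_exp_pulledBridgeFreeEnergy_sub : 2dy/(y+2d) + 2d(2d−1)y/(y+2d)² ≤ E − y` and
  ★★ **`second_order_sub_le_exp_pulledBridgeFreeEnergy : y + 2d − 2d/y − 8d³/y² ≤ e^{λ_B(y)}`** for every `y ≥ 1`, every `d`
  (the companion upper bound `e^{λ_B(y)} ≤ y + 2d − 2d/y + 2d(2d+1)/y²` is the next file's transfer-potential theorem).

Printed status: the large-force expansion `e^{λ_B(y)} = y + 2d − 2d/y + …` is Janse van Rensburg–Whittington (2013), §3.2 Theorem 8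
(first order, `ℤ^d`); explicit two-sided envelopes uniform in `d` are, to our knowledge, not in print.  Provenance: lane «pcv-sawmu»,
a-p3 g26 (2026-08-28).  PURE STD, no data, no `decide`.
-/

noncomputable section

open Finset Filter Topology
open scoped BigOperators
open Literature.Probability.LatticeModels
open Literature.Probability.RandomPlanarGeometry.SAW

namespace Literature.Probability.RandomPlanarGeometry.SAW.Zd

/-! ### The first three blocks -/

/-- `p_1(y) = u(y)`, `u = y e^{-λ_B(y)}`. [cite: Beaton2015, §3, Lemma 2] -/
theorem pulledBlockLaw_one_eq_largeForceUZd (d : ℕ) (y : ℝ) :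
    pulledBlockLaw (d + 1) y 1 = largeForceUZd d y := by
  rw [pulledBlockLaw_one, largeForceUZd]

/-- `p_2(y) = 2d·u²/y` (the `2d` irreducible bridges `+e₀, ±e_j`, span `1`). [cite: Beaton2015, §3, Lemma 1, eq. (7)] -/
theorem pulledBlockLaw_two_eq (d : ℕ) {y : ℝ} (hy : 0 < y) :
    pulledBlockLaw (d + 1) y 2 = 2 * d * largeForceUZd d y ^ 2 / y := by
  rw [pulledBlockLaw_eq_sum_costCoeffZd d hy 2]
  simp only [Finset.sum_range_succ, Finset.sum_range_zero, costCoeffZd_zero, costCoeffZd_one_two, costCoeffZd_two_two]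
  push_cast
  ring

/-- `p_3(y) = 2d(2d−1)·u³/y²` (the `2d(2d−1)` irreducible bridges `+e₀, ±e_j, ±e_{j'}` with `e_{j'} ≠ ∓e_j`, span `1`).
[cite: Beaton2015, §3, Lemma 1, eq. (7)] -/
theorem pulledBlockLaw_three_eq (d : ℕ) {y : ℝ} (hy : 0 < y) :
    pulledBlockLaw (d + 1) y 3 = 2 * d * (2 * d - 1) * largeForceUZd d y ^ 3 / y ^ 2 := by
  rw [pulledBlockLaw_eq_sum_costCoeffZd d hy 3]
  simp only [Finset.sum_range_succ, Finset.sum_range_zero, costCoeffZd_zero, costCoeffZd_one_of_ne_two d (show (3 : ℕ) ≠ 2 by norm_num),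
    costCoeffZd_two_three, costCoeffZd_eq_zero_of_le (d := d) (le_refl 3)]
  have h : ((2 * d * (2 * d - 1) : ℕ) : ℝ) = 2 * d * (2 * d - 1) := by
    rcases Nat.eq_zero_or_pos d with rfl | hd
    · simp
    · rw [Nat.cast_mul, Nat.cast_mul, Nat.cast_sub (by omega)]; push_cast; ring
  rw [h]
  push_cast
  ring

/-- **The three-block sub-Kesten inequality**: `u + 2d·u²/y + 2d(2d−1)·u³/y² ≤ 1` for every `y > 0` (`p_1 + p_2 + p_3 ≤ Σ_i p_i ≤ 1`, no
mass gap needed). [cite: Beaton2015, §3, Lemma 2; MadrasSlade1993, §4.2, eq. (4.2.15)] -/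
theorem largeForceUZd_three_blocks_le_one (d : ℕ) {y : ℝ} (hy : 0 < y) :
    largeForceUZd d y + 2 * d * largeForceUZd d y ^ 2 / y + 2 * d * (2 * d - 1) * largeForceUZd d y ^ 3 / y ^ 2 ≤ 1 := by
  have h := sum_range_pulledBlockLaw_le_one d hy 4
  simp only [Finset.sum_range_succ, Finset.sum_range_zero, pulledBlockLaw_zero, pulledBlockLaw_one_eq_largeForceUZd,
    pulledBlockLaw_two_eq d hy, pulledBlockLaw_three_eq d hy, zero_add] at h
  exact h

/-! ### Polynomial lower envelopes for `E = e^{λ_B(y)}` -/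

/-- ★★ **The cubic lower envelope**: `y·E² + 2d·y·E + 2d(2d−1)·y ≤ E³` for `E = e^{λ_B(y)}` on `ℤ^{d+1}`, every `y > 0`, every `d`
(the three-block inequality with `u = y/E`, multiplied by `E³`). [cite: Beaton2015, §3, Lemma 2] [cite: JansevanRensburgWhittington2013, §3.2 Theorem 8 (arXiv v4 p. 11)] -/
theorem exp_pulledBridgeFreeEnergy_cubic_le (d : ℕ) {y : ℝ} (hy : 0 < y) :
    y * Real.exp (pulledBridgeFreeEnergy (d + 1) y) ^ 2 + 2 * d * y * Real.exp (pulledBridgeFreeEnergy (d + 1) y)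
        + 2 * d * (2 * d - 1) * y ≤ Real.exp (pulledBridgeFreeEnergy (d + 1) y) ^ 3 := by
  set E := Real.exp (pulledBridgeFreeEnergy (d + 1) y) with hE
  have hE0 : 0 < E := Real.exp_pos _
  have hu : largeForceUZd d y = y / E := by rw [largeForceUZd, Real.exp_neg, div_eq_mul_inv]
  have h := largeForceUZd_three_blocks_le_one d hy
  rw [hu] at h
  have key : y / E + 2 * d * (y / E) ^ 2 / y + 2 * d * (2 * d - 1) * (y / E) ^ 3 / y ^ 2 =
      (y * E ^ 2 + 2 * d * y * E + 2 * d * (2 * d - 1) * y) / E ^ 3 := by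
    field_simp
  rw [key, div_le_one (by positivity)] at h
  exact h

/-- **The quadratic lower envelope**: `y·E + 2d·y ≤ E²` (drop the cubic block). [cite: Beaton2015, §3, Lemma 2] -/
theorem exp_pulledBridgeFreeEnergy_quadratic_le (d : ℕ) {y : ℝ} (hy : 0 < y) :
    y * Real.exp (pulledBridgeFreeEnergy (d + 1) y) + 2 * d * y ≤ Real.exp (pulledBridgeFreeEnergy (d + 1) y) ^ 2 := by
  set E := Real.exp (pulledBridgeFreeEnergy (d + 1) y) with hE
  have hE0 : 0 < E := Real.exp_pos _
  have h := exp_pulledBridgeFreeEnergy_cubic_le d hy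
  have hd1 : (0 : ℝ) ≤ 2 * d * (2 * d - 1) * y := by
    rcases Nat.eq_zero_or_pos d with rfl | hd
    · simp
    · have h1d : (1 : ℝ) ≤ d := by exact_mod_cast hd
      have h2d : (0 : ℝ) ≤ 2 * d - 1 := by linarith
      positivity
  -- `E·(yE + 2dy) ≤ yE² + 2dyE + 2d(2d−1)y ≤ E³ = E·E²`
  have h2 : E * (y * E + 2 * d * y) ≤ E * E ^ 2 := by nlinarith
  exact le_of_mul_le_mul_left h2 hE0

/-- ★★ **`(y + √(y² + 8dy))/2 ≤ e^{λ_B(y)}`** on `ℤ^{d+1}` for every `y > 0` and every `d` (the positive root of the quadratic envelope;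
`(y + √(y²+8dy))/2 = y + 2d − 4d²/y + O(d³/y²)`). [cite: JansevanRensburgWhittington2013, §3.2 Theorem 8 (arXiv v4 p. 11)] -/
theorem half_add_sqrt_le_exp_pulledBridgeFreeEnergy (d : ℕ) {y : ℝ} (hy : 0 < y) :
    (y + Real.sqrt (y ^ 2 + 8 * d * y)) / 2 ≤ Real.exp (pulledBridgeFreeEnergy (d + 1) y) := by
  set E := Real.exp (pulledBridgeFreeEnergy (d + 1) y) with hE
  have hq := exp_pulledBridgeFreeEnergy_quadratic_le d hy
  have hEy : y ≤ E := by
    have h := Real.exp_le_exp.2 (log_le_pulledBridgeFreeEnergy_zd d hy)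
    rwa [Real.exp_log hy] at h
  have h2 : y ^ 2 + 8 * d * y ≤ (2 * E - y) ^ 2 := by nlinarith
  have h3 : Real.sqrt (y ^ 2 + 8 * d * y) ≤ 2 * E - y := by
    rw [← Real.sqrt_sq (show (0 : ℝ) ≤ 2 * E - y by linarith)]
    exact Real.sqrt_le_sqrt h2
  linarith

/-- `e^{λ_B(y)} − y ≥ 2d·y / e^{λ_B(y)}` for every `y > 0` (the quadratic envelope divided by `E`). [cite: JansevanRensburgWhittington2013, §3.2 Theorem 8 (arXiv v4 p. 11)] -/
theorem two_mul_div_exp_le_exp_pulledBridgeFreeEnergy_sub (d : ℕ) {y : ℝ} (hy : 0 < y) :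
    2 * d * y / Real.exp (pulledBridgeFreeEnergy (d + 1) y) ≤ Real.exp (pulledBridgeFreeEnergy (d + 1) y) - y := by
  set E := Real.exp (pulledBridgeFreeEnergy (d + 1) y) with hE
  have hE0 : 0 < E := Real.exp_pos _
  have hq := exp_pulledBridgeFreeEnergy_quadratic_le d hy
  rw [div_le_iff₀ hE0]
  nlinarith

/-! ### Two-sided first-order envelope for `y ≥ 1` -/

/-- ★★ **`2d − 4d²/(y + 2d) ≤ e^{λ_B(y)} − y`** on `ℤ^{d+1}` for every `y ≥ 1` and every `d` (`E − y ≥ 2dy/E` and `E ≤ y + 2d`);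
with `exp_pulledBridgeFreeEnergy_le_add`: `2d·y/(y + 2d) ≤ e^{λ_B(y)} − y ≤ 2d`. [cite: JansevanRensburgWhittington2013, §3.2 eq. (3.12) and Theorem 8 (arXiv v4 pp. 9, 11)] -/
theorem two_mul_sub_le_exp_pulledBridgeFreeEnergy_sub (d : ℕ) {y : ℝ} (hy : 1 ≤ y) :
    2 * d - 4 * d ^ 2 / (y + 2 * d) ≤ Real.exp (pulledBridgeFreeEnergy (d + 1) y) - y := by
  have hy0 : 0 < y := zero_lt_one.trans_le hy
  set E := Real.exp (pulledBridgeFreeEnergy (d + 1) y) with hE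
  have hE0 : 0 < E := Real.exp_pos _
  have hup : E ≤ y + 2 * d := exp_pulledBridgeFreeEnergy_le_add d hy
  have hlow := two_mul_div_exp_le_exp_pulledBridgeFreeEnergy_sub d hy0
  have hyd : 0 < y + 2 * d := by positivity
  have h1 : 2 * d * y / (y + 2 * d) ≤ 2 * d * y / E := div_le_div_of_nonneg_left (by positivity) hE0 hup
  have h2 : 2 * (d : ℝ) - 4 * d ^ 2 / (y + 2 * d) = 2 * d * y / (y + 2 * d) := by field_simp; ring
  rw [h2]
  exact h1.trans hlow

/-- ★★ **EXPLICIT first-order remainder, uniform in the dimension**: `|e^{λ_B(y)} − (y + 2d)| ≤ 4d²/(y + 2d)` (`≤ 4d²/y`) on `ℤ^{d+1}` for every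
`y ≥ 1` and every `d` — the explicit form of the tree's `exp_pulledBridgeFreeEnergy_first_order_zd` (`∃ C y₁`). [cite: JansevanRensburgWhittington2013, §3.2 Theorem 8 (arXiv v4 p. 11)] -/
theorem abs_exp_pulledBridgeFreeEnergy_sub_first_order_le (d : ℕ) {y : ℝ} (hy : 1 ≤ y) :
    |Real.exp (pulledBridgeFreeEnergy (d + 1) y) - (y + 2 * d)| ≤ 4 * d ^ 2 / (y + 2 * d) := by
  have hup := exp_pulledBridgeFreeEnergy_le_add d hy
  have hlow := two_mul_sub_le_exp_pulledBridgeFreeEnergy_sub d hy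
  rw [abs_le]
  exact ⟨by linarith, by linarith [show (0 : ℝ) ≤ 4 * d ^ 2 / (y + 2 * d) by positivity]⟩

/-- The same sandwich for the free energy itself: `log(y + 2d) − 4d²/(y(y+2d)) ≤ λ_B(y) ≤ log(y + 2d)` for `y ≥ 1`
(`log` is `1/y`-Lipschitz on `[y, ∞)`). [cite: JansevanRensburgWhittington2013, §3.2 eq. (3.12) (arXiv v4 p. 9)] -/
theorem log_add_sub_le_pulledBridgeFreeEnergy (d : ℕ) {y : ℝ} (hy : 1 ≤ y) :
    Real.log (y + 2 * d) - 4 * d ^ 2 / (y * (y + 2 * d)) ≤ pulledBridgeFreeEnergy (d + 1) y ∧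
      pulledBridgeFreeEnergy (d + 1) y ≤ Real.log (y + 2 * d) := by
  have hy0 : 0 < y := zero_lt_one.trans_le hy
  refine ⟨?_, pulledBridgeFreeEnergy_le_log_add d hy⟩
  set E := Real.exp (pulledBridgeFreeEnergy (d + 1) y) with hE
  have hE0 : 0 < E := Real.exp_pos _
  have hEy : y ≤ E := (exp_pulledBridgeFreeEnergy_mem_Icc d hy).1
  have hlow := two_mul_sub_le_exp_pulledBridgeFreeEnergy_sub d hy
  have hyd : 0 < y + 2 * d := by positivity
  -- `log(y+2d) − log E ≤ ((y+2d) − E)/E ≤ (4d²/(y+2d))/y`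
  have h1 : Real.log (y + 2 * d) - Real.log E ≤ ((y + 2 * d) - E) / E := by
    have h := Real.log_le_sub_one_of_pos (show 0 < (y + 2 * d) / E by positivity)
    rw [Real.log_div hyd.ne' hE0.ne'] at h
    have : (y + 2 * d) / E - 1 = ((y + 2 * d) - E) / E := by field_simp
    linarith
  have h2 : ((y + 2 * d) - E) / E ≤ 4 * d ^ 2 / (y * (y + 2 * d)) := by
    rw [div_le_div_iff₀ hE0 (by positivity)]
    have h3 : (y + 2 * d - E) ≤ 4 * d ^ 2 / (y + 2 * d) := by linarith
    have h4 : 0 ≤ 4 * (d : ℝ) ^ 2 / (y + 2 * d) := by positivity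
    calc (y + 2 * d - E) * (y * (y + 2 * d)) ≤ 4 * d ^ 2 / (y + 2 * d) * (y * (y + 2 * d)) :=
          mul_le_mul_of_nonneg_right h3 (by positivity)
      _ = 4 * d ^ 2 * y := by field_simp
      _ ≤ 4 * d ^ 2 * E := mul_le_mul_of_nonneg_left hEy (by positivity)
  rw [hE, Real.log_exp] at h1
  linarith

/-! ### Second order from below: `e^{λ_B(y)} ≥ y + 2d − 2d/y − 8d³/y²` -/

/-- **Two blocks from below with the upper envelope inserted**: `2d·y/(y+2d) + 2d(2d−1)·y/(y+2d)² ≤ e^{λ_B(y)} − y` for every `y ≥ 1`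
(`E ≥ y + 2dy/E + 2d(2d−1)y/E²` from the cubic envelope, and `E ≤ y + 2d`). [cite: JansevanRensburgWhittington2013, §3.2 Theorem 8 (arXiv v4 p. 11)] -/
theorem two_blocks_le_exp_pulledBridgeFreeEnergy_sub (d : ℕ) {y : ℝ} (hy : 1 ≤ y) :
    2 * d * y / (y + 2 * d) + 2 * d * (2 * d - 1) * y / (y + 2 * d) ^ 2 ≤ Real.exp (pulledBridgeFreeEnergy (d + 1) y) - y := by
  have hy0 : 0 < y := zero_lt_one.trans_le hy
  set E := Real.exp (pulledBridgeFreeEnergy (d + 1) y) with hE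
  have hE0 : 0 < E := Real.exp_pos _
  have hup : E ≤ y + 2 * d := exp_pulledBridgeFreeEnergy_le_add d hy
  have hcub := exp_pulledBridgeFreeEnergy_cubic_le d hy0
  have hd1 : (0 : ℝ) ≤ 2 * d * (2 * d - 1) * y := by
    rcases Nat.eq_zero_or_pos d with rfl | hd
    · simp
    · have h1d : (1 : ℝ) ≤ d := by exact_mod_cast hd
      have h2d : (0 : ℝ) ≤ 2 * d - 1 := by linarith
      positivity
  -- `E − y ≥ 2dy/E + 2d(2d−1)y/E²`
  have h1 : 2 * d * y / E + 2 * d * (2 * d - 1) * y / E ^ 2 ≤ E - y := by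
    have : 2 * d * y / E + 2 * d * (2 * d - 1) * y / E ^ 2 = (2 * d * y * E + 2 * d * (2 * d - 1) * y) / E ^ 2 := by
      field_simp
    rw [this, div_le_iff₀ (by positivity)]
    nlinarith
  have hyd : 0 < y + 2 * d := by positivity
  have h2 : 2 * d * y / (y + 2 * d) ≤ 2 * d * y / E := div_le_div_of_nonneg_left (by positivity) hE0 hup
  have h3 : 2 * d * (2 * d - 1) * y / (y + 2 * d) ^ 2 ≤ 2 * d * (2 * d - 1) * y / E ^ 2 :=
    div_le_div_of_nonneg_left hd1 (by positivity) (pow_le_pow_left₀ hE0.le hup 2)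
  linarith

/-- ★★ **`y + 2d − 2d/y − 8d³/y² ≤ e^{λ_B(y)}`** on `ℤ^{d+1}` for every `y ≥ 1` and every `d`: the large-force expansion truncated after
its `1/y` term is a lower bound up to `8d³/y²`, uniformly (the two-block bound minus `2d − 2d/y − 8d³/y²` equals
`(8d²y² + (32d⁴ + 8d³)y + 32d⁵)/(y²(y+2d)²) ≥ 0`). [cite: JansevanRensburgWhittington2013, §3.2 Theorem 8 (arXiv v4 p. 11)] -/
theorem second_order_sub_le_exp_pulledBridgeFreeEnergy (d : ℕ) {y : ℝ} (hy : 1 ≤ y) :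
    y + 2 * d - 2 * d / y - 8 * d ^ 3 / y ^ 2 ≤ Real.exp (pulledBridgeFreeEnergy (d + 1) y) := by
  have hy0 : 0 < y := zero_lt_one.trans_le hy
  have h := two_blocks_le_exp_pulledBridgeFreeEnergy_sub d hy
  have hyd : 0 < y + 2 * d := by positivity
  have key : 2 * d * y / (y + 2 * d) + 2 * d * (2 * d - 1) * y / (y + 2 * d) ^ 2 - (2 * d - 2 * d / y - 8 * d ^ 3 / y ^ 2) =
      (8 * d ^ 2 * y ^ 2 + (32 * d ^ 4 + 8 * d ^ 3) * y + 32 * d ^ 5) / (y ^ 2 * (y + 2 * d) ^ 2) := by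
    field_simp
    ring
  have hpos : 0 ≤ (8 * d ^ 2 * y ^ 2 + (32 * d ^ 4 + 8 * d ^ 3) * y + 32 * (d : ℝ) ^ 5) / (y ^ 2 * (y + 2 * d) ^ 2) := by positivity
  linarith

end Literature.Probability.RandomPlanarGeometry.SAW.Zd
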